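import Summits.BirchSwinnertonDyer.BirchSwinnertonDyer.Theses.TameQuarticSolvent
import Summits.BirchSwinnertonDyer.BirchSwinnertonDyer.Theorems.TameQuarticSolventSolventPairLowerBoundPairGivenGoodFieldOf
import Summits.BirchSwinnertonDyer.BirchSwinnertonDyer.Theorems.TameQuarticSolventSolventPairLowerBoundTwistDatumOfFriedbergHoffstein
import HarnessLib

/-!
# Route `TameQuarticSolvent`, crux `SolventPairLowerBound` (stmt-BirchSwinnertonDyer-21391) — what the crux IS:
# the LOWER half of `BSD₃` for `E` over the real quadratic field `K = ℚ(√d)` (one Artin–Milne layer)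

HONEST FRAMING. Theorems only; helper (`--supports stmt-BirchSwinnertonDyer-21391`). Line `birth` reaches the
crux through the quartic `M = K(√β)`: `δ₃(E/M) = δ₃(E) + δ₃(E^{(d)}) + δ₃(E′)` with K1⁻ (`δ₃(E/M) ≤ 0`, OPEN) and
K2a (`δ₃(E′) ≥ 0`). This file records the ONE-LAYER bookkeeping `δ₃(E/K) = δ₃(E) + δ₃(E^{(d)})` over
`ℚ ⊂ K = ℚ(√d)` (Dokchitser–Dokchitser 2010 Thm. 2.3 / Milne 1972 for `K/ℚ`, the tree's named fact
`Milne1972.bsdQuotientP_baseChange_relQuadratic_anyModel`, plus `Λ(E/K) = Λ(E)·Λ(E^{(d)})`), and hence that the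
crux follows — GIVEN the same six published inputs as the skeleton — from the single statement
**LowerBSD₃OverRealQuadratic**: for `W` on the (t′) leaf, every `d > 0` with `ord₃ d = 1` and every quadratic
`K ∋ θ₁`, `θ₁² = d`: if `Ш(E_K/K)[3^∞]` is finite then `ord₃ #Ш_an(E_K/K) ≤ ord₃ #Ш(E_K/K)[3^∞]` — the lower half of
`BSD₃` for `E` over the REAL QUADRATIC field `ℚ(√d)`, at whose ramified prime `𝔭 ∣ 3` the curve is still additive
(Kodaira `I₀*`, `e(𝔭|3) = 2`). So K1⁻ ∧ K2a is one road to LowerBSD₃OverRealQuadratic (`δ₃(E/K) = δ₃(E/M) − δ₃(E′)`),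
and any other road to it closes the crux equally. Nothing here is progress on K1⁻/K2a/LowerBSD₃OverRealQuadratic
themselves (all implied by BSD, none in print); BSD is not proved by any of this. The route file is imported only
to conclude the crux decl BY NAME in the final conditional theorem (credits nothing).

WHAT.
* `padicValRat_analyticSha_quadratic` — for `W/ℚ` globally minimal, `K` quadratic with `θ₁² = c`, `θ₁ ∉ ℚ`,
  `Wc` a globally minimal model of `W^{(c)}`, `VK` any `K`-model of `W_K`, entire `L(W)`, `L(Wc)`, finite
  `Ш(W)[p^∞]`, `Ш(Wc)[p^∞]`, rational `#Ш_an(W) = qW`, `#Ш_an(Wc) = qWc`: `Ш(VK)[p^∞]` is finite, `#Ш_an(VK) = qK ∈ ℚˣ`,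
  and `δ_p(VK) = δ_p(W) + δ_p(Wc)`.
* `solventPairLowerBound_of_published_of_lowerBSD3OverRealQuadratic` — the crux BY NAME from the six published
  inputs and LowerBSD₃OverRealQuadratic (displayed hypothesis).

References: T. Dokchitser, V. Dokchitser, Ann. of Math. 172 (2010) Thm. 2.3; J. S. Milne, Invent. Math. 17 (1972)
Thm. 1; R. L. Miller, LMS J. Comput. Math. 14 (2011) §1; K. Ireland, M. Rosen, Prop. 20.5.4(b).
-/

-- D-0017: single-problem summit, so `Summit.BirchSwinnertonDyer.BirchSwinnertonDyer.…` repeats a namespace BY DESIGN.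
set_option linter.dupNamespace false

noncomputable section

open scoped NumberField Classical

open IsDedekindDomain NumberField WeierstrassCurve
  Literature.NumberTheory.EllipticCurves Literature.NumberTheory.EllipticCurves.ModularForms
  Literature.NumberTheory.EllipticCurves.Rank1Residual Summit.BirchSwinnertonDyer.Rank1Residual.Additive

namespace Summit.BirchSwinnertonDyer.BirchSwinnertonDyer.Theorems.SolventPairLowerBound

/-! ## The `BSD`-factor `B(X) = Reg·Ω·C/#tors²` -/

/-- `#Ш_an(X) · B(X) = Λ(X)` with `B(X) = Reg·Ω·C/#tors²` on any model of an elliptic curve over a number field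
(unfolding `analyticSha`; the factors are non-zero). [folklore] -/
theorem analyticSha_mul_bsdFactor {F : Type} [Field F] [NumberField F] (V : WeierstrassCurve F) [V.IsElliptic] :
    analyticSha V * ((V.regulator * V.bsdPeriod * (V.modifiedTamagawaProduct : ℝ) /
        (V.torsionOrder : ℝ) ^ 2 : ℝ) : ℂ) = V.leadingLCoeff := by
  have hΩ : (V.bsdPeriod : ℂ) ≠ 0 := by exact_mod_cast V.bsdPeriod_pos'.ne'
  have hc : (V.modifiedTamagawaProduct : ℂ) ≠ 0 := by
    exact_mod_cast (V.modifiedTamagawaProduct_pos).ne'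
  have hR : (V.regulator : ℂ) ≠ 0 := by exact_mod_cast V.regulator_pos'.ne'
  have ht : (V.torsionOrder : ℂ) ≠ 0 := by exact_mod_cast V.torsionOrder_pos_holds.ne'
  rw [analyticSha_def]
  push_cast
  field_simp

/-- `B(X) = Reg·Ω·C/#tors² ≠ 0` (all factors positive). [folklore] -/
theorem bsdFactor_ne_zero {F : Type} [Field F] [NumberField F] (V : WeierstrassCurve F) [V.IsElliptic] :
    ((V.regulator * V.bsdPeriod * (V.modifiedTamagawaProduct : ℝ) /
        (V.torsionOrder : ℝ) ^ 2 : ℝ) : ℂ) ≠ 0 := by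
  have hΩ : (0 : ℝ) < V.bsdPeriod := V.bsdPeriod_pos'
  have hc : (0 : ℝ) < V.modifiedTamagawaProduct := by exact_mod_cast V.modifiedTamagawaProduct_pos
  have hR : (0 : ℝ) < V.regulator := V.regulator_pos'
  have ht : (0 : ℝ) < V.torsionOrder := Nat.cast_pos.mpr V.torsionOrder_pos_holds
  exact_mod_cast (by positivity : (0 : ℝ) < V.regulator * V.bsdPeriod *
    (V.modifiedTamagawaProduct : ℝ) / (V.torsionOrder : ℝ) ^ 2).ne'

/-! ## One Artin–Milne layer: `δ_p(E/K) = δ_p(E) + δ_p(E^{(c)})` for `K = ℚ(√c)` -/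

/-- **`δ_p(E_K/K) = δ_p(E) + δ_p(E^{(c)})`**, `δ_p(X) = ord_p #Ш_an(X) − ord_p #Ш(X)[p^∞]`, for a quadratic field
`K = ℚ(θ₁)`, `θ₁² = c ∈ ℚ`, `θ₁ ∉ ℚ`. GIVEN Dokchitser–Dokchitser 2010 Thm. 2.3 (`p`-part) in Milne's
restriction-of-scalars form for `K/ℚ` (`hDD`): for `W/ℚ` globally minimal, `Wc` a globally minimal model of
`W^{(c)}`, `VK` any `K`-model of `W_K`, with `L(W)`, `L(Wc)` entire, `Ш(W)[p^∞]`, `Ш(Wc)[p^∞]` finite and rational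
`#Ш_an(W) = qW`, `#Ш_an(Wc) = qWc` (Miller's `shaAn`): `Ш(VK)[p^∞]` is finite, `#Ш_an(VK)` (`analyticSha`) is a
non-zero rational `qK`, and `ord_p qK − ord_p #Ш(VK)[p^∞] = (ord_p qW − ord_p #Ш(W)[p^∞]) +
(ord_p qWc − ord_p #Ш(Wc)[p^∞])`. Proof: the `BSD_p`-quotients multiply up to a `p`-unit rational (`hDD`), the
leading coefficients multiply (`leadingLCoeff_baseChange_relQuadratic`, Ireland–Rosen 20.5.4(b)), and
`#Ш_an · B = Λ` on each curve. (The two-layer version over `ℚ ⊂ K ⊂ M` is the tree's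
`padicValRat_analyticSha_quadraticTower`.) [cite: DokchitserDokchitserAnnals2010, §2.1 Thm. 2.3 (second clause) and its proof]
[cite: Miller2011LMS, §1 and Def. 1.1 (arXiv:1010.2431 p. 3)] [cite: IrelandRosen1990, Ch. 20 §5, Prop. 20.5.4(b)] -/
theorem padicValRat_analyticSha_quadratic (hDD : Milne1972.bsdQuotientP_baseChange_relQuadratic_anyModel)
    (W : WeierstrassCurve ℚ) [W.IsElliptic] [W.IsGloballyMinimal]
    (K : Type) [Field K] [NumberField K] (h2 : Module.finrank ℚ K = 2)
    {c : ℚ} {θ₁ : K} (hθ₁ : θ₁ ^ 2 = algebraMap ℚ K c) (hθK : θ₁ ∉ Set.range (algebraMap ℚ K))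
    (Wc : WeierstrassCurve ℚ) [Wc.IsElliptic] [Wc.IsGloballyMinimal]
    (hWc : ∃ C : WeierstrassCurve.VariableChange ℚ, C • W.quadraticTwist c = Wc)
    (VK : WeierstrassCurve K) [VK.IsElliptic]
    (hVK : ∃ C : WeierstrassCurve.VariableChange K, C • W.baseChange K = VK)
    (p : ℕ) [Fact p.Prime]
    (hfW : Finite (AddCommGroup.primaryComponent W.sha p))
    (hfWc : Finite (AddCommGroup.primaryComponent Wc.sha p))
    (hW : W.HasEntireLFunction) (hWcL : Wc.HasEntireLFunction)
    {qW qWc : ℚ} (hqW : shaAn W = (qW : ℂ)) (hqWc : shaAn Wc = (qWc : ℂ)) :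
    Finite (AddCommGroup.primaryComponent VK.sha p) ∧
    ∃ qK : ℚ, analyticSha VK = (qK : ℂ) ∧ qK ≠ 0 ∧ qW ≠ 0 ∧ qWc ≠ 0 ∧
      padicValRat p qK - padicValNat p (Nat.card (AddCommGroup.primaryComponent VK.sha p)) =
        (padicValRat p qW - padicValNat p (Nat.card (AddCommGroup.primaryComponent W.sha p))) +
        (padicValRat p qWc - padicValNat p (Nat.card (AddCommGroup.primaryComponent Wc.sha p))) := by
  have hc0 : c ≠ 0 := by
    rintro rfl
    rw [map_zero, pow_eq_zero_iff two_ne_zero] at hθ₁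
    exact hθK ⟨0, by rw [map_zero, hθ₁]⟩
  haveI := W.isElliptic_quadraticTwist hc0
  haveI : (W.baseChange K).IsElliptic := by
    rw [WeierstrassCurve.baseChange]; infer_instance
  -- Dokchitser–Dokchitser / Milne for `K/ℚ` on the models `W`, `Wc`, `VK`
  obtain ⟨hfVK, r, hr0, hrp, hQ⟩ := hDD ℚ K h2 c θ₁ hθ₁ hθK W Wc hWc VK hVK p hfW hfWc
  refine ⟨hfVK, ?_⟩
  -- the leading coefficients multiply, transported to the models
  obtain ⟨Cc, hCc⟩ := hWc
  obtain ⟨CK, hCK⟩ := hVK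
  have hWcL' : (W.quadraticTwist c).HasEntireLFunction := by
    rw [← hasEntireLFunction_smul_iff _ Cc, hCc]; exact hWcL
  have hΛ : VK.leadingLCoeff = W.leadingLCoeff * Wc.leadingLCoeff := by
    rw [← hCK, ← hCc, leadingLCoeff_smul, leadingLCoeff_smul]
    exact W.leadingLCoeff_baseChange_relQuadratic K h2 hθ₁ hθK hW hWcL'
  -- the `BSD_p` identity (any-model currency on all three curves), cast to `ℂ`
  set NVK := Nat.card (AddCommGroup.primaryComponent VK.sha p) with hNVK
  set NW := Nat.card (AddCommGroup.primaryComponent W.sha p) with hNW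
  set NWc := Nat.card (AddCommGroup.primaryComponent Wc.sha p) with hNWc
  set bVK : ℝ := VK.regulator * VK.bsdPeriod * (VK.modifiedTamagawaProduct : ℝ) /
    (VK.torsionOrder : ℝ) ^ 2 with hbVK
  set bW : ℝ := W.regulator * W.bsdPeriod * (W.modifiedTamagawaProduct : ℝ) /
    (W.torsionOrder : ℝ) ^ 2 with hbW
  set bWc : ℝ := Wc.regulator * Wc.bsdPeriod * (Wc.modifiedTamagawaProduct : ℝ) /
    (Wc.torsionOrder : ℝ) ^ 2 with hbWc
  have hQ' : (NVK : ℝ) * bVK = (r : ℝ) * ((NW : ℝ) * bW) * ((NWc : ℝ) * bWc) := by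
    rw [hbVK, hbW, hbWc]
    linear_combination hQ
  have hQc : (NVK : ℂ) * (bVK : ℂ) = (r : ℂ) * ((NW : ℂ) * (bW : ℂ)) * ((NWc : ℂ) * (bWc : ℂ)) := by
    have := congrArg (fun x : ℝ => (x : ℂ)) hQ'
    push_cast at this
    exact_mod_cast this
  -- `#Ш_an · B = Λ` for the three curves
  have aVK : analyticSha VK * (bVK : ℂ) = VK.leadingLCoeff := analyticSha_mul_bsdFactor VK
  have aW : analyticSha W * (bW : ℂ) = W.leadingLCoeff := analyticSha_mul_bsdFactor W
  have aWc : analyticSha Wc * (bWc : ℂ) = Wc.leadingLCoeff := analyticSha_mul_bsdFactor Wc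
  have hb : (bVK : ℂ) * ((bW : ℂ) * (bWc : ℂ)) ≠ 0 :=
    mul_ne_zero (bsdFactor_ne_zero VK) (mul_ne_zero (bsdFactor_ne_zero W) (bsdFactor_ne_zero Wc))
  have hprod : analyticSha VK * (r : ℂ) * (NW : ℂ) * (NWc : ℂ) =
      (NVK : ℂ) * (analyticSha W * analyticSha Wc) := by
    apply mul_right_cancel₀ hb
    calc analyticSha VK * (r : ℂ) * (NW : ℂ) * (NWc : ℂ) * ((bVK : ℂ) * ((bW : ℂ) * (bWc : ℂ)))
        = (analyticSha VK * (bVK : ℂ)) * ((r : ℂ) * ((NW : ℂ) * (bW : ℂ)) * ((NWc : ℂ) * (bWc : ℂ))) := by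
          ring
      _ = VK.leadingLCoeff * ((NVK : ℂ) * (bVK : ℂ)) := by rw [aVK, hQc]
      _ = (NVK : ℂ) * ((analyticSha W * (bW : ℂ)) * (analyticSha Wc * (bWc : ℂ))) * (bVK : ℂ) := by
          rw [aW, aWc, hΛ]; ring
      _ = (NVK : ℂ) * (analyticSha W * analyticSha Wc) * ((bVK : ℂ) * ((bW : ℂ) * (bWc : ℂ))) := by ring
  -- rationality and non-vanishing
  rw [← analyticSha_eq_shaAn] at hqW hqWc
  have hne : ∀ {F : Type} [Field F] [NumberField F] (V : WeierstrassCurve F) [V.IsElliptic],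
      V.HasEntireLFunction → analyticSha V ≠ 0 := by
    intro F _ _ V _ hV h0
    have h := analyticSha_mul_bsdFactor V
    rw [h0, zero_mul] at h
    exact V.leadingLCoeff_ne_zero_holds hV h.symm
  have hqW0 : qW ≠ 0 := by
    intro h; apply hne W hW; rw [hqW, h, Rat.cast_zero]
  have hqWc0 : qWc ≠ 0 := by
    intro h; apply hne Wc hWcL; rw [hqWc, h, Rat.cast_zero]
  haveI := hfVK; haveI := hfW; haveI := hfWc
  have hNVK0 : NVK ≠ 0 := Nat.card_pos.ne'
  have hNW0 : NW ≠ 0 := Nat.card_pos.ne'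
  have hNWc0 : NWc ≠ 0 := Nat.card_pos.ne'
  set qK : ℚ := (NVK : ℚ) * (qW * qWc) / (r * NW * NWc) with hqK_def
  have hden : (r : ℚ) * NW * NWc ≠ 0 := by
    refine mul_ne_zero (mul_ne_zero hr0 ?_) ?_ <;> exact_mod_cast ‹_ ≠ 0›
  have hqK : analyticSha VK = (qK : ℂ) := by
    rw [hqW, hqWc] at hprod
    have hdenC' : ((r : ℂ) * (NW : ℂ) * (NWc : ℂ)) ≠ 0 := by exact_mod_cast hden
    rw [hqK_def]
    push_cast
    rw [eq_div_iff hdenC']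
    linear_combination hprod
  have hqK0 : qK ≠ 0 := by
    rw [hqK_def]
    exact div_ne_zero (mul_ne_zero (by exact_mod_cast hNVK0) (mul_ne_zero hqW0 hqWc0)) hden
  refine ⟨qK, hqK, hqK0, hqW0, hqWc0, ?_⟩
  have hvK : padicValRat p qK =
      padicValNat p NVK + (padicValRat p qW + padicValRat p qWc) - (padicValNat p NW + padicValNat p NWc) := by
    rw [hqK_def, padicValRat.div (mul_ne_zero (by exact_mod_cast hNVK0) (mul_ne_zero hqW0 hqWc0)) hden,
      padicValRat.mul (by exact_mod_cast hNVK0) (mul_ne_zero hqW0 hqWc0), padicValRat.mul hqW0 hqWc0,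
      padicValRat.mul (mul_ne_zero hr0 (by exact_mod_cast hNW0)) (by exact_mod_cast hNWc0),
      padicValRat.mul hr0 (by exact_mod_cast hNW0), hrp, padicValRat.of_nat, padicValRat.of_nat,
      padicValRat.of_nat]
    ring
  rw [hvK]
  ring

/-! ## The crux by name from LowerBSD₃OverRealQuadratic (CONDITIONAL) -/

/-- **Crux `SolventPairLowerBound` from six published inputs and the LOWER half of `BSD₃` for `E` over the
real quadratic field `ℚ(√d)`.** GIVEN modularity (`hmod`, `hmodP`), Gross–Zagier Thm. I.(7.3) (`hGZ`),
Gross–Zagier–Kolyvagin (`hGZK`), Dokchitser–Dokchitser 2010 Thm. 2.3 in Milne's form (`hDD`), Friedberg–Hoffstein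
Thm. B(1) at `3` (`hFH`) and the displayed hypothesis LowerBSD₃OverRealQuadratic — «for `W` on the (t′) leaf, every
`d > 0` with `ord₃ d = 1` and every quadratic `K ∋ θ₁`, `θ₁² = d`: if `Ш(W_K/K)[3^∞]` is finite then every rational
value `qK` of `#Ш_an(W_K/K)` has `ord₃ qK ≤ ord₃ #Ш(W_K/K)[3^∞]`» — the crux holds: the admissible rank-zero twist
(`stub_twistDatum_of_friedbergHoffstein`), `K = ℚ(√d)` (`exists_quadraticField_sq_eq_intCast`), the one-layer
identity `δ₃(W_K) = δ₃(W) + δ₃(W^{(d)})` (`padicValRat_analyticSha_quadratic`) and `linarith`. CONDITIONAL; credits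
nothing toward closing the item; it displays that the deciding crux of route `TameQuarticSolvent` is exactly the
lower `BSD₃` bound for `E` over the real quadratic field where `E` is still additive (`I₀*`) at the ramified prime
above `3` — line `birth` (K1⁻ ∧ K2a over the quartic `M = K(√β)`) being one road to it.
[cite: DokchitserDokchitserAnnals2010, §2.1 Thm. 2.3] [cite: FriedbergHoffstein1995, Thm. B (1)]
[cite: GrossZagier1986, Thm. I.(7.3)] [cite: Milne1972ArithmeticAV, §1 Thm. 1] -/
theorem solventPairLowerBound_of_published_of_lowerBSD3OverRealQuadratic
    (hmod : exists_isNewformOf) (hmodP : nonempty_modularParametrizationData)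
    (hGZ : GrossZagier1986_thm_I_7_3) (hGZK : rank_eq_analyticRank_of_analyticRank_le_one)
    (hDD : Milne1972.bsdQuotientP_baseChange_relQuadratic_anyModel)
    (hFH : friedbergHoffstein_exists_pos_twist_ne_zero_ramifiedAtThree)
    (LowerK : ∀ (W : WeierstrassCurve ℚ) [W.IsElliptic] [W.IsGloballyMinimal],
      ¬ W.HasCM → Addv W 3 → Summit.BirchSwinnertonDyer.Rank1Residual.Additive.SubTprime W 3 →
      W.analyticRank = 1 →
      ∀ (d : ℤ), 0 < d → padicValInt 3 d = 1 →
      ∀ (K : Type) [Field K] [NumberField K] (θ₁ : K), Module.finrank ℚ K = 2 → θ₁ ^ 2 = (d : K) →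
        Finite (AddCommGroup.primaryComponent (W.baseChange K).sha 3) →
        ∀ qK : ℚ, analyticSha (W.baseChange K) = (qK : ℂ) →
          padicValRat 3 qK ≤ padicValNat 3 (Nat.card (AddCommGroup.primaryComponent (W.baseChange K).sha 3))) :
    Summit.BirchSwinnertonDyer.BirchSwinnertonDyer.Theses.TameQuarticSolvent.SolventPairLowerBound := by
  intro W _ _ hCM hadd hsub hr
  obtain ⟨d, Wd, i1, i2, hd0, hd, hWd, hCMd, haddd, hsubd, hr0⟩ :=
    stub_twistDatum_of_friedbergHoffstein hmod hFH W hCM hadd hsub hr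
  refine ⟨d, Wd, i1, i2, hd0, hd, hWd, hCMd, haddd, hsubd, hr0, ?_⟩
  -- published inputs over `ℚ`
  have hE : hasEntireLFunction_rat := WeierstrassCurve.hasEntireLFunction_rat_of_exists_isNewformOf hmod
  obtain ⟨qW, hqW⟩ := Disegni2020.exists_rat_shaAn_eq_of_analyticRank_eq_one hGZ hGZK W hr
  obtain ⟨qWd, hqWd⟩ := exists_rat_shaAn_eq_of_analyticRank_eq_zero hmodP hGZK Wd hr0
  haveI : Finite W.sha := (hGZK W (by omega)).2
  haveI : Finite Wd.sha := (hGZK Wd (by omega)).2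
  -- the real quadratic field `K = ℚ(√d)`
  obtain ⟨K, _, _, θ₁, h2, hθ₁, hθK⟩ :=
    exists_quadraticField_sq_eq_intCast (not_isSquare_ratCast_of_padicValInt_eq_one 3 hd)
  haveI : (W.baseChange K).IsElliptic := by
    rw [WeierstrassCurve.baseChange]; infer_instance
  have hθ₁' : θ₁ ^ 2 = algebraMap ℚ K (d : ℚ) := by rw [hθ₁, map_intCast]
  -- one Artin–Milne layer over `ℚ ⊂ K`
  obtain ⟨hfK, qK, hqK, -, -, -, hδ⟩ :=
    padicValRat_analyticSha_quadratic hDD W K h2 hθ₁' hθK Wd hWd (W.baseChange K) ⟨1, one_smul _ _⟩ 3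
      inferInstance inferInstance (hE W) (hE Wd) hqW hqWd
  have hlow := LowerK W hCM hadd hsub hr d hd0 hd K θ₁ h2 hθ₁ hfK qK hqK
  refine ⟨qW, qWd, hqW, hqWd, ?_⟩
  have h : padicValRat 3 qW + padicValRat 3 qWd ≤
      (padicValNat 3 (Nat.card (AddCommGroup.primaryComponent W.sha 3)) : ℤ) +
        (padicValNat 3 (Nat.card (AddCommGroup.primaryComponent Wd.sha 3)) : ℤ) := by
    linarith
  rwa [padicValNat_card_addPrimaryComponent (A := W.sha) 3,
    padicValNat_card_addPrimaryComponent (A := Wd.sha) 3] at h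

end Summit.BirchSwinnertonDyer.BirchSwinnertonDyer.Theorems.SolventPairLowerBound

end
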